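import Mathlib
import HarnessLib
import Literature.Analysis.Calculus.FunctionalDependence
import Literature.Analysis.FluidPDE.SteadyLiouvilleTsaiKit
import Literature.Geometry.Riemannian.MeanConvexFlatFrameSum
import Summits.NavierStokesRegularity.NavierStokesRegularity.Theorems.PoloidalWindowDoorPoloidalWindowRigidityClebschDynamics
import Summits.NavierStokesRegularity.NavierStokesRegularity.Theorems.PoloidalWindowDoorPoloidalWindowRigidityStructureFunctionSlope
import Summits.NavierStokesRegularity.NavierStokesRegularity.Theorems.PoloidalWindowDoorPoloidalWindowRigidityUntwistedSeparation

/-!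
# Route `PoloidalWindowDoor`, crux `PoloidalWindowRigidity` (K2, stmt-NavierStokesRegularity-19708), skeleton `lrc-jet` v5,
# stub `stub_untwisted` — brick F2a: THE DYNAMIC SCALAR `T = ∂ₜψ + (v·∇)ψ − Δψ` OF A POLOIDAL PROFILE IS LEAFWISE,
# and the chain rules (Laplacian of a local leaf composition, time derivative of a structure-function identity) that expand it

Cell ns-regularity-ideate, seat ns-poloidal-K2-p2 (gen 5; stub-worker under the K2 lead ns-poloidal-K2-p1 g6; file landed
`--supports stmt-NavierStokesRegularity-19708` as a helper toward the registered stub `stub_untwisted` of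
`Cruxes/PoloidalWindowRigidity/Lines/lrc_jet.lean` v5; brick F2 of the lead's `BRIEF-v5-bricks-v2.md` (S5): the NS₃ normal form (V0) of
`Cruxes/PoloidalWindowRigidity/UNTWISTED-NOTE.md` §1 in structure-function currency).  This first file isolates the ONE dynamic input of
(V0) and the generic calculus; the sequel `…UntwistedDynamics` assembles (K1), (V0) and the transport rule in the hypothesis format of the
lead's separation files `…UntwistedSeparation{,2}`.

THE MECHANISM.  Write the slices of a poloidal class profile in the tree's Clebsch form `v = ∇φ + ψe₂` (time-dependent line potential `φ`,
stream function `ψ = v₂ − ∂₂φ`; `…Clebsch`, `…ClebschDynamics`) and put `T := ∂ₜψ + (v·∇)ψ − Δψ`.  The tree's (E2)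
`∇ₕT = ∂₂ψ ∇ₕv₂ − ∂₂v₂ ∇ₕψ` (`clebsch_T_equation`, the vorticity equation in Clebsch variables) and the frozen constraint
`{ψ, v₂}ₕ = 0` (`frozen_bracket` + `stub_firstIntegral`) give AT ONCE `{T, v₂}ₕ = ∂₀T·∂₁v₂ − ∂₁T·∂₀v₂ = ∂₂v₂·{ψ, v₂}ₕ = 0`:
**the dynamic scalar is constant along the vortex lines of every horizontal plane** (no untwistedness, no slope hypothesis), hence near
every point with `∇ₕv₂ ≠ 0` it is a function `τ(v₂, x₂)` of the vertical velocity and the height (functional dependence,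
`Literature.Analysis.Calculus.exists_comp_slice`).  Expanding `T = 𝓛[F̃(t, v₂, x₂)]` by the chain rule (ns-poloidal-K2-p3's structure
function `ψ = F̃(t, v₂, x₂)`, p531376) is then exactly UNTWISTED-NOTE's (V0) with `1 − Λ = F̃_w` — done in the sequel.

* `differentiableAt_dirPartial` — bookkeeping on `ℝ × ℝ` (with the tree's `Literature.Geometry.Riemannian.clm_prod_apply_eq`).
* `laplacian_of_leafwise` — **Laplacian of a LOCAL leaf composition**: `f, w ∈ C²(ℝ³)`, `f = G(w, y₂)` on an open `U` with `G` of class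
  `C²` at the leaf points ⇒ `Δf = G_w Δw + G_ww Σᵢ(∂ᵢw)² + (G_wz + G_zw) ∂₂w + G_zz` on `U` (partials of `G` as `fderiv`s in the directions
  `(1,0)`, `(0,1)`; no symmetry of second derivatives is used, so both mixed partials appear).
* `hasDerivAt_time_of_eq_structureFunction` — **chain rule in time** for `f = F(t, g, y₂)` near a space–time point:
  `∂ₜf = F_t + F_q ∂ₜg` (companion of K2-p3's slice version `…StructureFunctionSlope.hasFDerivAt_slice_of_eq_structureFunction`).
* `linePotential_pair_spec` — the explicit time-dependent Clebsch pair (line potential + stream function) of a class profile: joint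
  smoothness on the slab, smooth slices, `∂₀φ = v₀`, `∂₁φ = v₁`, `v₂ = ∂₂φ + ψ`, `curl v = (∂₁ψ, −∂₀ψ, 0)`, (E1) `Δφ + ∂₂ψ = 0`
  (the content of `…Clebsch.exists_clebsch_uncurry`, with the pair exposed by formula so that `clebsch_T_equation` applies to it).
* `contDiff_dynScalar` — `T(t, ·)` is smooth;  `dynScalar_bracket_eq_zero` — **`{T, v₂}ₕ = 0` at every point of every slice**;
  `exists_dynScalar_eq_leafwise` — **`T = τ(v₂, x₂)` near every point with `∇ₕv₂ ≠ 0`**, `τ` of class `Cⁿ` at the base leaf point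
  (any `n ≠ 0` up to `∞`).

WHAT THIS IS NOT: not a claim about Navier–Stokes regularity and not the stub — the dynamic input of brick F2 and its calculus (bears_on
LADDER-NS N0 via crux K2 = stmt-19708).
-/

noncomputable section

-- the summit and its single sub-problem share the name (CONVENTIONS §1), as in every Theorems file
set_option linter.dupNamespace false

namespace Summit.NavierStokesRegularity.NavierStokesRegularity.Theorems.PoloidalWindowDoorPoloidalWindowRigidityStructureFunctionDynamics

open Set Function Filter Topology Metric
open scoped RealInnerProductSpace InnerProductSpace Laplacian ContDiff
open Literature.Analysis Literature.Analysis.FluidPDE Literature.Analysis.Calculus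
open Literature.Geometry.Riemannian (clm_prod_apply_eq)
open Summit.NavierStokesRegularity.NavierStokesRegularity.Theorems.PoloidalWindowDoorPoloidalWindowRigidityConstantShearMeans
open Summit.NavierStokesRegularity.NavierStokesRegularity.Theorems.PoloidalWindowDoorLrcModEntireLeafwiseVertical
open Summit.NavierStokesRegularity.NavierStokesRegularity.Theorems.PoloidalWindowDoorPoloidalWindowRigidityUntwistedSeparation

/-! ### Calculus on `ℝ × ℝ`: directional partials of a structure function -/

/-- A directional partial `q ↦ DG(q) u` of a function `G : ℝ × ℝ → ℝ` that is `C²` at `p` is differentiable at `p`. [folklore] -/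
theorem differentiableAt_dirPartial {G : ℝ × ℝ → ℝ} {p : ℝ × ℝ} (hG : ContDiffAt ℝ 2 G p) (u : ℝ × ℝ) :
    DifferentiableAt ℝ (fun q => fderiv ℝ G q u) p := by
  have h1 : ContDiffAt ℝ 1 (fderiv ℝ G) p := hG.fderiv_right (m := 1) (by norm_num)
  exact (h1.clm_apply contDiffAt_const).differentiableAt one_ne_zero

/-! ### The Laplacian of a function that is LOCALLY a leaf composition `G(w, y₂)` -/

/-- **Laplacian of a local leaf composition.**  Let `f, w : ℝ³ → ℝ` be `C²`, `U` open, and suppose `f(y) = G(w(y), y₂)` on `U`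
with `G : ℝ × ℝ → ℝ` of class `C²` at the leaf points `(w y, y₂)`, `y ∈ U`.  Then on `U`
`Δf = G_w·Δw + G_ww·Σᵢ(∂ᵢw)² + (G_wz + G_zw)·∂₂w + G_zz`, all partials of `G` at `(w y, y₂)`
(`G_w = DG(1,0)`, `G_ww = D[DG(1,0)](1,0)`, `G_wz = D[DG(1,0)](0,1)`, `G_zw = D[DG(0,1)](1,0)`, `G_zz = D[DG(0,1)](0,1)`). [folklore] -/
theorem laplacian_of_leafwise {f w : EuclideanSpace ℝ (Fin 3) → ℝ} {G : ℝ × ℝ → ℝ} {U : Set (EuclideanSpace ℝ (Fin 3))}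
    (hU : IsOpen U) (hf : ContDiff ℝ 2 f) (hw : ContDiff ℝ 2 w)
    (hG : ∀ y ∈ U, ContDiffAt ℝ 2 G (w y, y 2))
    (hfG : ∀ y ∈ U, f y = G (w y, y 2)) {y : EuclideanSpace ℝ (Fin 3)} (hy : y ∈ U) :
    Δ f y = fderiv ℝ G (w y, y 2) (1, 0) * Δ w y +
      fderiv ℝ (fun q => fderiv ℝ G q ((1 : ℝ), (0 : ℝ))) (w y, y 2) (1, 0) *
        (∑ i : Fin 3, fderiv ℝ w y (EuclideanSpace.single i (1 : ℝ)) ^ 2) +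
      (fderiv ℝ (fun q => fderiv ℝ G q ((1 : ℝ), (0 : ℝ))) (w y, y 2) (0, 1) +
          fderiv ℝ (fun q => fderiv ℝ G q ((0 : ℝ), (1 : ℝ))) (w y, y 2) (1, 0)) *
        fderiv ℝ w y (EuclideanSpace.single 2 (1 : ℝ)) +
      fderiv ℝ (fun q => fderiv ℝ G q ((0 : ℝ), (1 : ℝ))) (w y, y 2) (0, 1) := by
  have hwd : Differentiable ℝ w := hw.differentiable (by norm_num)
  have hGd : ∀ y' ∈ U, DifferentiableAt ℝ G (w y', y' 2) := fun y' hy' => (hG y' hy').differentiableAt (by norm_num)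
  set Gw : ℝ × ℝ → ℝ := fun q => fderiv ℝ G q ((1 : ℝ), (0 : ℝ)) with hGw
  set Gz : ℝ × ℝ → ℝ := fun q => fderiv ℝ G q ((0 : ℝ), (1 : ℝ)) with hGz
  -- the first partials of `f` near `y`, through the leaf chain rule
  have h1 : ∀ i : Fin 3, (fun y' => fderiv ℝ f y' (EuclideanSpace.single i (1 : ℝ))) =ᶠ[𝓝 y]
      fun y' => fderiv ℝ w y' (EuclideanSpace.single i (1 : ℝ)) * Gw (w y', y' 2) +
        (EuclideanSpace.single i (1 : ℝ) : EuclideanSpace ℝ (Fin 3)) 2 * Gz (w y', y' 2) := by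
    intro i
    filter_upwards [hU.mem_nhds hy] with y' hy'
    have hloc : f =ᶠ[𝓝 y'] fun y'' => G (w y'', y'' 2) := by
      filter_upwards [hU.mem_nhds hy'] with y'' hy'' using hfG y'' hy''
    rw [hloc.fderiv_eq, fderiv_leaf_comp (hGd y' hy') (hwd y'), clm_prod_apply_eq]
  -- second partials at `y`
  have hd1 : ∀ a : EuclideanSpace ℝ (Fin 3), DifferentiableAt ℝ (fun y' => fderiv ℝ w y' a) y := fun a =>
    differentiableAt_partial hw a y
  have hGwd : DifferentiableAt ℝ Gw (w y, y 2) := differentiableAt_dirPartial (hG y hy) _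
  have hGzd : DifferentiableAt ℝ Gz (w y, y 2) := differentiableAt_dirPartial (hG y hy) _
  have hA : DifferentiableAt ℝ (fun y' : EuclideanSpace ℝ (Fin 3) => Gw (w y', y' 2)) y := differentiableAt_leaf_comp hGwd (hwd y)
  have hB : DifferentiableAt ℝ (fun y' : EuclideanSpace ℝ (Fin 3) => Gz (w y', y' 2)) y := differentiableAt_leaf_comp hGzd (hwd y)
  have h2 : ∀ i : Fin 3,
      fderiv ℝ (fun y' => fderiv ℝ f y' (EuclideanSpace.single i (1 : ℝ))) y (EuclideanSpace.single i (1 : ℝ)) =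
        fderiv ℝ (fun y' => fderiv ℝ w y' (EuclideanSpace.single i (1 : ℝ))) y (EuclideanSpace.single i (1 : ℝ)) * Gw (w y, y 2) +
          fderiv ℝ w y (EuclideanSpace.single i (1 : ℝ)) *
            (fderiv ℝ w y (EuclideanSpace.single i (1 : ℝ)) * fderiv ℝ Gw (w y, y 2) (1, 0) +
              (EuclideanSpace.single i (1 : ℝ) : EuclideanSpace ℝ (Fin 3)) 2 * fderiv ℝ Gw (w y, y 2) (0, 1)) +
          (EuclideanSpace.single i (1 : ℝ) : EuclideanSpace ℝ (Fin 3)) 2 *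
            (fderiv ℝ w y (EuclideanSpace.single i (1 : ℝ)) * fderiv ℝ Gz (w y, y 2) (1, 0) +
              (EuclideanSpace.single i (1 : ℝ) : EuclideanSpace ℝ (Fin 3)) 2 * fderiv ℝ Gz (w y, y 2) (0, 1)) := by
    intro i
    rw [(h1 i).fderiv_eq]
    have hP1 : DifferentiableAt ℝ (fun y' : EuclideanSpace ℝ (Fin 3) =>
        fderiv ℝ w y' (EuclideanSpace.single i (1 : ℝ)) * Gw (w y', y' 2)) y := (hd1 _).mul hA
    have hP2 : DifferentiableAt ℝ (fun y' : EuclideanSpace ℝ (Fin 3) =>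
        (EuclideanSpace.single i (1 : ℝ) : EuclideanSpace ℝ (Fin 3)) 2 * Gz (w y', y' 2)) y := (differentiableAt_const _).mul hB
    rw [fderiv_fun_add hP1 hP2]
    simp only [_root_.add_apply]
    rw [fderiv_mul_apply (hd1 _) hA, fderiv_mul_apply (differentiableAt_const _) hB,
      fderiv_leaf_comp hGwd (hwd y), fderiv_leaf_comp hGzd (hwd y),
      clm_prod_apply_eq (fderiv ℝ Gw (w y, y 2)) (fderiv ℝ w y (EuclideanSpace.single i (1 : ℝ))) _,
      clm_prod_apply_eq (fderiv ℝ Gz (w y, y 2)) (fderiv ℝ w y (EuclideanSpace.single i (1 : ℝ))) _,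
      fderiv_fun_const]
    simp only [Pi.zero_apply, _root_.zero_apply, mul_zero, add_zero]
    ring
  rw [Literature.Analysis.FluidPDE.Tsai2021.laplacian_eq_sum_three hf y,
    Literature.Analysis.FluidPDE.Tsai2021.laplacian_eq_sum_three hw y]
  simp only [h2, Fin.sum_univ_three]
  have e0 : (EuclideanSpace.single (0 : Fin 3) (1 : ℝ) : EuclideanSpace ℝ (Fin 3)) 2 = 0 := by simp
  have e1 : (EuclideanSpace.single (1 : Fin 3) (1 : ℝ) : EuclideanSpace ℝ (Fin 3)) 2 = 0 := by simp
  have e2 : (EuclideanSpace.single (2 : Fin 3) (1 : ℝ) : EuclideanSpace ℝ (Fin 3)) 2 = 1 := by simp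
  rw [e0, e1, e2]
  ring


/-! ### Chain rule in time for a space–time structure-function identity `f = F(t, g, y₂)` -/

/-- **Chain rule in time.**  If `f τ y = F (τ, g τ y, y₂)` for all `(τ, y)` near `(t₀, y₀)`, with `uncurry g` differentiable near
`(t₀, y₀)` and continuous there, and `F : ℝ × ℝ × ℝ → ℝ` of class `Cⁿ` (`n ≠ 0`) at `(t₀, g t₀ y₀, (y₀)₂)`, then for all `(τ, y)` near
`(t₀, y₀)` the time line `s ↦ f s y` has at `τ` the derivative `F_t + F_q · (d/ds) g s y |_τ`, the partials of `F` taken at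
`(τ, g τ y, y₂)` (`F_t = DF(1,0,0)`, `F_q = DF(0,1,0)`).  Companion of ns-poloidal-K2-p3's slice version
`…StructureFunctionSlope.hasFDerivAt_slice_of_eq_structureFunction`. [folklore] -/
theorem hasDerivAt_time_of_eq_structureFunction {n : WithTop ℕ∞} (hn : n ≠ 0)
    {f g : ℝ → EuclideanSpace ℝ (Fin 3) → ℝ} {F : ℝ × ℝ × ℝ → ℝ} {t₀ : ℝ} {y₀ : EuclideanSpace ℝ (Fin 3)}
    (hg : ∀ᶠ z in 𝓝 (t₀, y₀), DifferentiableAt ℝ (uncurry g) z)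
    (hF : ContDiffAt ℝ n F (t₀, g t₀ y₀, y₀ 2))
    (hcontg : ContinuousAt (uncurry g) (t₀, y₀))
    (heq : ∀ᶠ z in 𝓝 (t₀, y₀), f z.1 z.2 = F (z.1, g z.1 z.2, z.2 2)) :
    ∀ᶠ z in 𝓝 (t₀, y₀), HasDerivAt (fun τ => f τ z.2)
      (fderiv ℝ F (z.1, g z.1 z.2, z.2 2) ((1 : ℝ), (0 : ℝ), (0 : ℝ)) +
        fderiv ℝ F (z.1, g z.1 z.2, z.2 2) ((0 : ℝ), (1 : ℝ), (0 : ℝ)) * deriv (fun τ => g τ z.2) z.1) z.1 := by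
  have hn1 : (1 : WithTop ℕ∞) ≤ n := ENat.one_le_iff_ne_zero_withTop.mpr hn
  have hF1 : ∀ᶠ p in 𝓝 (t₀, g t₀ y₀, y₀ 2), DifferentiableAt ℝ F p :=
    ((hF.of_le hn1).eventually (by simp)).mono fun p hp => hp.differentiableAt one_ne_zero
  have hT : Tendsto (fun z : ℝ × EuclideanSpace ℝ (Fin 3) => (z.1, g z.1 z.2, z.2 2)) (𝓝 (t₀, y₀))
      (𝓝 (t₀, g t₀ y₀, y₀ 2)) := by
    have h1 : ContinuousAt (fun z : ℝ × EuclideanSpace ℝ (Fin 3) => z.1) (t₀, y₀) := continuousAt_fst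
    have h3 : ContinuousAt (fun z : ℝ × EuclideanSpace ℝ (Fin 3) => z.2 2) (t₀, y₀) :=
      ((EuclideanSpace.proj (2 : Fin 3) : EuclideanSpace ℝ (Fin 3) →L[ℝ] ℝ).continuous.continuousAt).comp
        continuousAt_snd
    exact (h1.prodMk (hcontg.prodMk h3)).tendsto
  filter_upwards [hg.eventually_nhds, heq.eventually_nhds, hT.eventually hF1] with z hgz heqz hFz
  obtain ⟨t, y⟩ := z
  -- the time line through `(t, y)`
  have hι : Tendsto (fun τ : ℝ => ((τ, y) : ℝ × EuclideanSpace ℝ (Fin 3))) (𝓝 t) (𝓝 (t, y)) :=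
    (continuousAt_id.prodMk continuousAt_const).tendsto
  have heqt : ∀ᶠ τ in 𝓝 t, f τ y = F (τ, g τ y, y 2) := hι.eventually heqz
  have hgt : DifferentiableAt ℝ (fun τ => g τ y) t := by
    have h := (hgz.self_of_nhds : DifferentiableAt ℝ (uncurry g) (t, y))
    have h2 : DifferentiableAt ℝ (fun τ : ℝ => ((τ, y) : ℝ × EuclideanSpace ℝ (Fin 3))) t :=
      differentiableAt_id.prodMk (differentiableAt_const _)
    exact h.comp t h2
  -- the curve `τ ↦ (τ, g τ y, y₂)` and the composition with `F`
  have hγ : HasDerivAt (fun τ : ℝ => ((τ, g τ y, y 2) : ℝ × ℝ × ℝ)) ((1 : ℝ), deriv (fun τ => g τ y) t, (0 : ℝ)) t :=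
    (hasDerivAt_id t).prodMk (hgt.hasDerivAt.prodMk (hasDerivAt_const t (y 2)))
  have hcomp : HasDerivAt (fun τ : ℝ => F (τ, g τ y, y 2))
      (fderiv ℝ F (t, g t y, y 2) ((1 : ℝ), deriv (fun τ => g τ y) t, (0 : ℝ))) t :=
    (hFz : DifferentiableAt ℝ F (t, g t y, y 2)).hasFDerivAt.comp_hasDerivAt t hγ
  have hf : HasDerivAt (fun τ => f τ y) (fderiv ℝ F (t, g t y, y 2) ((1 : ℝ), deriv (fun τ => g τ y) t, (0 : ℝ))) t :=
    hcomp.congr_of_eventuallyEq heqt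
  have hdec : ((1 : ℝ), deriv (fun τ => g τ y) t, (0 : ℝ)) =
      ((1 : ℝ), (0 : ℝ), (0 : ℝ)) + deriv (fun τ => g τ y) t • ((0 : ℝ), (1 : ℝ), (0 : ℝ)) := by
    ext <;> simp
  rw [hdec, map_add, map_smul, smul_eq_mul] at hf
  convert hf using 1
  ring

/-! ### The time-dependent Clebsch pair of a poloidal profile of the class -/

section Profile

variable {C : ℝ} {v : ℝ → EuclideanSpace ℝ (Fin 3) → EuclideanSpace ℝ (Fin 3)}

open Literature.Analysis.FluidPDE.VerticalVorticityFree
open Summit.NavierStokesRegularity.NavierStokesRegularity.Theorems.LocalSineTubeDoorProfileAlignedWindowRigidityAncient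
open Summit.NavierStokesRegularity.NavierStokesRegularity.Theorems.PoloidalWindowDoorPoloidalWindowRigidityClebsch
open Summit.NavierStokesRegularity.NavierStokesRegularity.Theorems.PoloidalWindowDoorPoloidalWindowRigidityClebschDynamics
open Summit.NavierStokesRegularity.NavierStokesRegularity.Theorems.PoloidalWindowDoorPoloidalWindowRigidityFirstIntegral

/-- **The time-dependent Clebsch pair, by formula.**  For a profile of the route's Type-I class, poloidal along `e₃`, the horizontal LINE
POTENTIAL `φ t` of the slice `v t` and the STREAM FUNCTION `ψ t := (v t)₂ − ∂₂(φ t)` (the explicit pair behind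
`…Clebsch.exists_clebsch_uncurry` and `…ClebschDynamics.clebsch_T_equation`) are jointly smooth on the slab, with smooth slices, and for
every `t < 0`: `∂₀(φ t) = v₀`, `∂₁(φ t) = v₁`, `v₂ = ∂₂(φ t) + ψ t`, `curl (v t) = (∂₁ψ, −∂₀ψ, 0)` and (E1) `Δ(φ t) + ∂₂(ψ t) = 0`.
[folklore] -/
theorem linePotential_pair_spec (hrate : HasTypeITimeDecay C v)
    (hcont : ContinuousOn (uncurry v) (Iio (0 : ℝ) ×ˢ univ))
    (hmild : ∀ s t : ℝ, s < t → t < 0 → ∀ x,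
      v t x = UnboundedOperators.heatExtension (v s) (t - s) x - oseenDuhamel 1 s v v t x)
    (hdiv : ∀ t < 0, VectorCalculus.IsDivFree (v t))
    (hpol : ∀ s < 0, ∀ y, ⟪curl (v s) y, EuclideanSpace.single 2 1⟫_ℝ = 0)
    {φ ψ : ℝ → EuclideanSpace ℝ (Fin 3) → ℝ}
    (hφ : φ = fun (t : ℝ) (x : EuclideanSpace ℝ (Fin 3)) =>
      ∫ σ in (0 : ℝ)..1, ⟪v t (σ • (x - x 2 • (EuclideanSpace.single (2 : Fin 3) (1 : ℝ))) +
        x 2 • (EuclideanSpace.single (2 : Fin 3) (1 : ℝ))), x - x 2 • (EuclideanSpace.single (2 : Fin 3) (1 : ℝ))⟫_ℝ)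
    (hψ : ψ = fun t y => v t y 2 - fderiv ℝ (φ t) y (EuclideanSpace.single 2 1)) :
    IsSmoothSpaceTimeOn (Iio (0 : ℝ)) φ ∧ IsSmoothSpaceTimeOn (Iio (0 : ℝ)) ψ ∧
    ∀ t < 0, ContDiff ℝ ∞ (φ t) ∧ ContDiff ℝ ∞ (ψ t) ∧
      (∀ y, fderiv ℝ (φ t) y (EuclideanSpace.single 0 1) = v t y 0) ∧
      (∀ y, fderiv ℝ (φ t) y (EuclideanSpace.single 1 1) = v t y 1) ∧
      (∀ y, v t y 2 = fderiv ℝ (φ t) y (EuclideanSpace.single 2 1) + ψ t y) ∧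
      (∀ y, curl (v t) y 0 = fderiv ℝ (ψ t) y (EuclideanSpace.single 1 1) ∧
        curl (v t) y 1 = -fderiv ℝ (ψ t) y (EuclideanSpace.single 0 1) ∧ curl (v t) y 2 = 0) ∧
      (∀ y, (Δ (φ t)) y + fderiv ℝ (ψ t) y (EuclideanSpace.single 2 1) = 0) := by
  have hsm : ContDiffOn ℝ ∞ (uncurry v) (Iio (0 : ℝ) ×ˢ univ) :=
    (analyticOnNhd_uncurry hcont (bdd_of_hasTypeITimeDecay hrate) hmild).contDiffOn_of_completeSpace
  have hS : UniqueDiffOn ℝ (Iio (0 : ℝ)) := isOpen_Iio.uniqueDiffOn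
  have hφs : IsSmoothSpaceTimeOn (Iio (0 : ℝ)) φ := by
    rw [hφ]; exact contDiffOn_linePotential_uncurry hsm
  have hψs : IsSmoothSpaceTimeOn (Iio (0 : ℝ)) ψ := by
    have h1 : ContDiffOn ℝ ∞ (fun q : ℝ × EuclideanSpace ℝ (Fin 3) => (uncurry v) q 2) (Iio (0 : ℝ) ×ˢ univ) :=
      (EuclideanSpace.proj (2 : Fin 3) : EuclideanSpace ℝ (Fin 3) →L[ℝ] ℝ).contDiff.comp_contDiffOn hsm
    have h2 : ContDiffOn ℝ ∞ (fun q : ℝ × EuclideanSpace ℝ (Fin 3) =>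
        (uncurry (fun t x => fderiv ℝ (φ t) x)) q (EuclideanSpace.single 2 1)) (Iio (0 : ℝ) ×ˢ univ) :=
      ContDiffOn.clm_apply (show ContDiffOn ℝ ∞ (uncurry fun t x => fderiv ℝ (φ t) x)
        (Iio (0 : ℝ) ×ˢ univ) from hφs.fderiv_slice hS) contDiffOn_const
    rw [hψ]
    exact (h1.sub h2).congr fun q _ => by rcases q with ⟨s, z⟩; rfl
  refine ⟨hφs, hψs, fun t ht => ?_⟩
  have hV : ContDiff ℝ ∞ (v t) := contDiff_slice hrate hcont hmild ht
  have hc2 : ∀ y, curl (v t) y 2 = 0 := fun y => curl_two_eq_zero hpol ht y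
  have hφt : φ t = fun x : EuclideanSpace ℝ (Fin 3) =>
      ∫ σ in (0 : ℝ)..1, ⟪v t (σ • (x - x 2 • (EuclideanSpace.single (2 : Fin 3) (1 : ℝ))) +
        x 2 • (EuclideanSpace.single (2 : Fin 3) (1 : ℝ))),
        x - x 2 • (EuclideanSpace.single (2 : Fin 3) (1 : ℝ))⟫_ℝ := by rw [hφ]
  have hψt : ψ t = fun y => v t y 2 - fderiv ℝ (φ t) y (EuclideanSpace.single 2 1) := by rw [hψ]
  have h0 : ∀ y, fderiv ℝ (φ t) y (EuclideanSpace.single 0 1) = v t y 0 := fun y => by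
    rw [hφt]; exact fderiv_linePotential_single hV hc2 y (Or.inl rfl)
  have h1 : ∀ y, fderiv ℝ (φ t) y (EuclideanSpace.single 1 1) = v t y 1 := fun y => by
    rw [hφt]; exact fderiv_linePotential_single hV hc2 y (Or.inr rfl)
  have h2 : ∀ y, v t y 2 = fderiv ℝ (φ t) y (EuclideanSpace.single 2 1) + ψ t y := fun y => by
    rw [hψt]; ring
  have hcomp : ∀ y, curl (v t) y 0 = fderiv ℝ (ψ t) y (EuclideanSpace.single 1 1) ∧
      curl (v t) y 1 = -fderiv ℝ (ψ t) y (EuclideanSpace.single 0 1) ∧ curl (v t) y 2 = 0 := fun y => by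
    rw [hψt]; exact curl_apply_eq_fderiv_stream hV hc2 hφt y
  refine ⟨hφs.contDiff_slice ht, hψs.contDiff_slice ht, h0, h1, h2, hcomp, fun y => ?_⟩
  rw [hψt, ← divergence_eq_laplacian_add_fderiv_stream hV hc2 hφt y]
  exact hdiv t ht y

/-- **The dynamic scalar `T = ∂ₜψ + (v·∇)ψ − Δψ` has smooth slices.** [folklore] -/
theorem contDiff_dynScalar (hrate : HasTypeITimeDecay C v)
    (hcont : ContinuousOn (uncurry v) (Iio (0 : ℝ) ×ˢ univ))
    (hmild : ∀ s t : ℝ, s < t → t < 0 → ∀ x,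
      v t x = UnboundedOperators.heatExtension (v s) (t - s) x - oseenDuhamel 1 s v v t x)
    (hdiv : ∀ t < 0, VectorCalculus.IsDivFree (v t))
    (hpol : ∀ s < 0, ∀ y, ⟪curl (v s) y, EuclideanSpace.single 2 1⟫_ℝ = 0)
    {φ ψ : ℝ → EuclideanSpace ℝ (Fin 3) → ℝ}
    (hφ : φ = fun (t : ℝ) (x : EuclideanSpace ℝ (Fin 3)) =>
      ∫ σ in (0 : ℝ)..1, ⟪v t (σ • (x - x 2 • (EuclideanSpace.single (2 : Fin 3) (1 : ℝ))) +
        x 2 • (EuclideanSpace.single (2 : Fin 3) (1 : ℝ))), x - x 2 • (EuclideanSpace.single (2 : Fin 3) (1 : ℝ))⟫_ℝ)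
    (hψ : ψ = fun t y => v t y 2 - fderiv ℝ (φ t) y (EuclideanSpace.single 2 1)) {t : ℝ} (ht : t < 0) :
    ContDiff ℝ ∞ (fun z => deriv (fun s => ψ s z) t + (convect (v t) (ψ t) z - Δ (ψ t) z)) := by
  obtain ⟨-, hψs, hslice⟩ := linePotential_pair_spec hrate hcont hmild hdiv hpol hφ hψ
  obtain ⟨-, hψsl, -⟩ := hslice t ht
  have hS : UniqueDiffOn ℝ (Iio (0 : ℝ)) := isOpen_Iio.uniqueDiffOn
  have hV : ContDiff ℝ ∞ (v t) := contDiff_slice hrate hcont hmild ht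
  have hTd : ContDiff ℝ ∞ (fun z => deriv (fun s => ψ s z) t) := by
    have h := (IsSmoothSpaceTimeOn.timeDerivWithin hψs hS).contDiff_slice ht
    have e : timeDerivWithin (Iio (0 : ℝ)) ψ t = fun z => deriv (fun s => ψ s z) t := by
      funext z; rw [timeDerivWithin_apply, derivWithin_of_isOpen isOpen_Iio ht]
    rw [e] at h
    exact h
  have hdc : ContDiff ℝ ∞ fun z => convect (v t) (ψ t) z := (hψsl.fderiv_right (m := ∞) le_rfl).clm_apply hV
  have hdl : ContDiff ℝ ∞ (Δ (ψ t)) := contDiff_laplacian (n := ⊤) (hψsl.of_le (le_of_eq rfl))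
  exact hTd.add (hdc.sub hdl)

/-- **THE DYNAMIC SCALAR IS CONSTANT ALONG THE VORTEX LINES: `{T, v₂}ₕ = 0` on every slice.**  For a profile of the route's Type-I
class, poloidal along `e₃`, with the time-dependent Clebsch pair `φ, ψ` and `T := ∂ₜψ + (v·∇)ψ − Δψ`: at every point of every slice
`∂₀T·∂₁v₂ − ∂₁T·∂₀v₂ = 0`.  Proof: the tree's (E2) `∇ₕT = ∂₂ψ∇ₕv₂ − ∂₂v₂∇ₕψ` (`…ClebschDynamics.clebsch_T_equation`, the vorticity
equation in Clebsch variables) and the frozen constraint `{ψ, v₂}ₕ = 0` (`…Clebsch.frozen_bracket` with `stub_firstIntegral`). [folklore] -/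
theorem dynScalar_bracket_eq_zero (hrate : HasTypeITimeDecay C v)
    (hcont : ContinuousOn (uncurry v) (Iio (0 : ℝ) ×ˢ univ))
    (hmild : ∀ s t : ℝ, s < t → t < 0 → ∀ x,
      v t x = UnboundedOperators.heatExtension (v s) (t - s) x - oseenDuhamel 1 s v v t x)
    (hdiv : ∀ t < 0, VectorCalculus.IsDivFree (v t))
    (hpol : ∀ s < 0, ∀ y, ⟪curl (v s) y, EuclideanSpace.single 2 1⟫_ℝ = 0)
    {φ ψ : ℝ → EuclideanSpace ℝ (Fin 3) → ℝ}
    (hφ : φ = fun (t : ℝ) (x : EuclideanSpace ℝ (Fin 3)) =>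
      ∫ σ in (0 : ℝ)..1, ⟪v t (σ • (x - x 2 • (EuclideanSpace.single (2 : Fin 3) (1 : ℝ))) +
        x 2 • (EuclideanSpace.single (2 : Fin 3) (1 : ℝ))), x - x 2 • (EuclideanSpace.single (2 : Fin 3) (1 : ℝ))⟫_ℝ)
    (hψ : ψ = fun t y => v t y 2 - fderiv ℝ (φ t) y (EuclideanSpace.single 2 1)) {t : ℝ} (ht : t < 0)
    (y : EuclideanSpace ℝ (Fin 3)) :
    fderiv ℝ (fun z => deriv (fun s => ψ s z) t + (convect (v t) (ψ t) z - Δ (ψ t) z)) y (EuclideanSpace.single 0 1) *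
        fderiv ℝ (v t) y (EuclideanSpace.single 1 1) 2 -
      fderiv ℝ (fun z => deriv (fun s => ψ s z) t + (convect (v t) (ψ t) z - Δ (ψ t) z)) y (EuclideanSpace.single 1 1) *
        fderiv ℝ (v t) y (EuclideanSpace.single 0 1) 2 = 0 := by
  obtain ⟨h1, h0⟩ := clebsch_T_equation hrate hcont hmild hdiv hpol hφ hψ ht y
  obtain ⟨-, -, hslice⟩ := linePotential_pair_spec hrate hcont hmild hdiv hpol hφ hψ
  obtain ⟨-, -, -, -, -, hcurl, -⟩ := hslice t ht
  have hfro := frozen_bracket (v := v)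
    (stub_firstIntegral C v hrate hcont hmild hdiv (EuclideanSpace.single 2 1) hpol t ht) (ψ := ψ t) hcurl y
  rw [h0, h1]
  linear_combination fderiv ℝ (v t) y (EuclideanSpace.single 2 1) 2 * hfro

/-- **The dynamic scalar is LEAFWISE near every point with `∇ₕv₂ ≠ 0`**: there `T(t,y) = τ(v₂(t,y), y₂)` for a function `τ : ℝ × ℝ → ℝ`
of class `Cⁿ` at the base leaf point (any `n ≠ 0` up to `∞`; functional dependence `Literature.Analysis.Calculus.exists_comp_slice` applied to
`dynScalar_bracket_eq_zero`). [folklore] -/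
theorem exists_dynScalar_eq_leafwise {n : ℕ∞} (hn : n ≠ 0) (hrate : HasTypeITimeDecay C v)
    (hcont : ContinuousOn (uncurry v) (Iio (0 : ℝ) ×ˢ univ))
    (hmild : ∀ s t : ℝ, s < t → t < 0 → ∀ x,
      v t x = UnboundedOperators.heatExtension (v s) (t - s) x - oseenDuhamel 1 s v v t x)
    (hdiv : ∀ t < 0, VectorCalculus.IsDivFree (v t))
    (hpol : ∀ s < 0, ∀ y, ⟪curl (v s) y, EuclideanSpace.single 2 1⟫_ℝ = 0)
    {φ ψ : ℝ → EuclideanSpace ℝ (Fin 3) → ℝ}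
    (hφ : φ = fun (t : ℝ) (x : EuclideanSpace ℝ (Fin 3)) =>
      ∫ σ in (0 : ℝ)..1, ⟪v t (σ • (x - x 2 • (EuclideanSpace.single (2 : Fin 3) (1 : ℝ))) +
        x 2 • (EuclideanSpace.single (2 : Fin 3) (1 : ℝ))), x - x 2 • (EuclideanSpace.single (2 : Fin 3) (1 : ℝ))⟫_ℝ)
    (hψ : ψ = fun t y => v t y 2 - fderiv ℝ (φ t) y (EuclideanSpace.single 2 1)) {t : ℝ} (ht : t < 0)
    {y₀ : EuclideanSpace ℝ (Fin 3)}
    (hne : fderiv ℝ (v t) y₀ (EuclideanSpace.single 0 1) 2 ≠ 0 ∨ fderiv ℝ (v t) y₀ (EuclideanSpace.single 1 1) 2 ≠ 0) :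
    ∃ τ : ℝ × ℝ → ℝ, ContDiffAt ℝ n τ (v t y₀ 2, y₀ 2) ∧
      ∀ᶠ y in 𝓝 y₀, deriv (fun s => ψ s y) t + (convect (v t) (ψ t) y - Δ (ψ t) y) = τ (v t y 2, y 2) := by
  have hn' : (n : WithTop ℕ∞) ≠ 0 := by exact_mod_cast hn
  have hV : ContDiff ℝ ∞ (v t) := contDiff_slice hrate hcont hmild ht
  have hVd : Differentiable ℝ (v t) := hV.differentiable (by simp)
  have hT : ContDiff ℝ ∞ (fun z => deriv (fun s => ψ s z) t + (convect (v t) (ψ t) z - Δ (ψ t) z)) :=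
    contDiff_dynScalar hrate hcont hmild hdiv hpol hφ hψ ht
  have hw : ContDiff ℝ ∞ (fun y => v t y 2) := contDiff_coord hV 2
  have hTa : ContDiffAt ℝ (n : WithTop ℕ∞) (fun z => deriv (fun s => ψ s z) t + (convect (v t) (ψ t) z - Δ (ψ t) z)) y₀ :=
    (hT.of_le (by exact_mod_cast le_top)).contDiffAt
  have hwa : ContDiffAt ℝ (n : WithTop ℕ∞) (fun y => v t y 2) y₀ := (hw.of_le (by exact_mod_cast le_top)).contDiffAt
  have hbr : ∀ y, fderiv ℝ (fun z => deriv (fun s => ψ s z) t + (convect (v t) (ψ t) z - Δ (ψ t) z)) y (EuclideanSpace.single 0 1) *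
        fderiv ℝ (fun y => v t y 2) y (EuclideanSpace.single 1 1) =
      fderiv ℝ (fun z => deriv (fun s => ψ s z) t + (convect (v t) (ψ t) z - Δ (ψ t) z)) y (EuclideanSpace.single 1 1) *
        fderiv ℝ (fun y => v t y 2) y (EuclideanSpace.single 0 1) := by
    intro y
    rw [fderiv_apply_coord (hVd y), fderiv_apply_coord (hVd y)]
    linear_combination dynScalar_bracket_eq_zero hrate hcont hmild hdiv hpol hφ hψ ht y
  rcases hne with h0 | h1
  · have hpin : fderiv ℝ (fun y => v t y 2) y₀ (EuclideanSpace.single 0 1) ≠ 0 := by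
      rwa [fderiv_apply_coord (hVd y₀)]
    obtain ⟨G, hG, hGeq⟩ := exists_comp_slice hn' (b₀ := 0) (b₁ := 1) (by decide) (by decide) (by decide) hTa hwa hpin
      (Eventually.of_forall fun y => hbr y)
    exact ⟨G, hG, hGeq⟩
  · have hpin : fderiv ℝ (fun y => v t y 2) y₀ (EuclideanSpace.single 1 1) ≠ 0 := by
      rwa [fderiv_apply_coord (hVd y₀)]
    obtain ⟨G, hG, hGeq⟩ := exists_comp_slice hn' (b₀ := 1) (b₁ := 0) (by decide) (by decide) (by decide) hTa hwa hpin
      (Eventually.of_forall fun y => (hbr y).symm)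
    exact ⟨G, hG, hGeq⟩

end Profile

end Summit.NavierStokesRegularity.NavierStokesRegularity.Theorems.PoloidalWindowDoorPoloidalWindowRigidityStructureFunctionDynamics

end
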